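import Summits.CriticalPhenomena.CardyFormulaZ2.Theorems.CardyFlipRussoVoronoiHubFromSmirnovDefs
import Literature.Probability.Percolation.VoronoiCrossing
import Literature.Probability.LatticeModels.DelaunayGraph

/-!
# Stub `mem_blackRegion_iff_exists_voronoiCell` of line `moebius-exact-delaunay-dilation-ward`
# (crux `VoronoiHubFromSmirnov`, stmt-CriticalPhenomena-6433)

**The black region is the union of the black Voronoi cells** (Bollobás–Riordan, *Percolation*
(CUP 2006), Ch. 8 §8.1: "a point `x` is black if and only if a point of `𝒫` at minimal distance
from `x` is open").

The crux phrases the colour of a point `z` through distances: `z` is black for the nucleus sets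
`(B, W)` (black nuclei `B`, white nuclei `W`) iff `infDist z B ≤ infDist z W`
(`Literature.Probability.Percolation.blackRegion`).  Voronoi percolation read as SITE percolation
on the Delaunay graph phrases it through cells: `z` is black iff it lies in the closed Voronoi
cell — with respect to ALL the nuclei `B ∪ W` — of some black nucleus
(`Literature.Probability.LatticeModels.voronoiCell`).  For `B` locally finite (finite
intersection with every compact set) and `B`, `W` nonempty the two descriptions agree; this is
the bridge from the continuum crossing event to site percolation on the Delaunay graph.

Proof.  (→) `infDist z B` is attained (`brc_exists_infDist_eq_dist`): pick `b₁ ∈ B`; the set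
`F := B ∩ closedBall z (dist z b₁)` is finite (the closed ball is compact, `ℂ` being proper) and
contains `b₁`; a minimiser `b₀` of `dist z ·` on `F` minimises `dist z ·` on all of `B` (a nucleus
outside the closed ball is farther from `z` than `b₁`, hence than `b₀`).  So
`dist z b₀ ≤ infDist z B ≤ infDist z W ≤ dist z w` for every `w ∈ W`, and `dist z b₀ ≤ dist z b`
for every `b ∈ B`: `z ∈ voronoiCell (B ∪ W) b₀`.  (←) If `b ∈ B` and `dist z b ≤ dist z q` for
all `q ∈ B ∪ W`, then `infDist z B ≤ dist z b ≤ infDist z W`.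

No new definitions; Mathlib only (`Set.exists_min_image`, `isCompact_closedBall`,
`Metric.infDist_le_dist_of_mem`, `Metric.le_infDist`).
-/

noncomputable section

namespace Summit.CriticalPhenomena.CardyFormulaZ2.Cruxes.VoronoiHubFromSmirnov.MoebiusExactDelaunayDilationWard

open Set Metric

/-- **Nearest nucleus.** In a proper (pseudo)metric space, a nonempty locally finite set `B`
(finite intersection with every compact set) has a point nearest to any given point `z`: some
`b₀ ∈ B` with `dist z b₀ ≤ dist z b` for all `b ∈ B`. -/
theorem brc_exists_forall_dist_le {X : Type*} [PseudoMetricSpace X] [ProperSpace X] {B : Set X}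
    (hB : ∀ K : Set X, IsCompact K → (B ∩ K).Finite) (hBne : B.Nonempty) (z : X) :
    ∃ b₀ ∈ B, ∀ b ∈ B, dist z b₀ ≤ dist z b := by
  obtain ⟨b₁, hb₁⟩ := hBne
  -- a minimiser of `dist z ·` over the finitely many nuclei of the closed ball through `b₁`
  obtain ⟨b₀, ⟨hb₀B, -⟩, hmin⟩ :=
    (B ∩ closedBall z (dist z b₁)).exists_min_image (fun b => dist z b)
      (hB _ (isCompact_closedBall z (dist z b₁))) ⟨b₁, hb₁, mem_closedBall'.2 le_rfl⟩
  refine ⟨b₀, hb₀B, fun b hb => ?_⟩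
  by_cases hbR : dist z b ≤ dist z b₁
  · exact hmin b ⟨hb, mem_closedBall'.2 hbR⟩
  · exact (hmin b₁ ⟨hb₁, mem_closedBall'.2 le_rfl⟩).trans (not_le.1 hbR).le

/-- **Nearest nucleus realises `infDist`.** Under the hypotheses of `brc_exists_forall_dist_le`,
`infDist z B = dist z b₀` for some `b₀ ∈ B`. -/
theorem brc_exists_infDist_eq_dist {X : Type*} [PseudoMetricSpace X] [ProperSpace X] {B : Set X}
    (hB : ∀ K : Set X, IsCompact K → (B ∩ K).Finite) (hBne : B.Nonempty) (z : X) :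
    ∃ b₀ ∈ B, infDist z B = dist z b₀ := by
  obtain ⟨b₀, hb₀B, hmin⟩ := brc_exists_forall_dist_le hB hBne z
  exact ⟨b₀, hb₀B, le_antisymm (infDist_le_dist_of_mem hb₀B) ((le_infDist hBne).2 hmin)⟩

/-- **The black region is the union of the black cells** (Bollobás–Riordan 2006, Ch. 8 §8.1):
for `B` locally finite and `B`, `W` nonempty, a point `z` is black for `(B, W)`
(`infDist z B ≤ infDist z W`) iff `z` lies in the closed Voronoi cell, with respect to all the
nuclei `B ∪ W`, of some black nucleus `b ∈ B`. -/
theorem mem_blackRegion_iff_exists_voronoiCell : ∀ (B W : Set ℂ) (z : ℂ), (∀ K : Set ℂ, IsCompact K → (B ∩ K).Finite) → B.Nonempty → W.Nonempty → (z ∈ Literature.Probability.Percolation.blackRegion B W ↔ ∃ b ∈ B, z ∈ Literature.Probability.LatticeModels.voronoiCell (B ∪ W) b) := by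
  intro B W z hB hBne hWne
  rw [Literature.Probability.Percolation.mem_blackRegion]
  constructor
  · -- (→): a nearest black nucleus `b₀` (`infDist z B = dist z b₀`) works.
    intro hz
    obtain ⟨b₀, hb₀B, hb₀⟩ := brc_exists_infDist_eq_dist hB hBne z
    refine ⟨b₀, hb₀B, Literature.Probability.LatticeModels.mem_voronoiCell_iff.2 ?_⟩
    rw [← hb₀]
    rintro q (hqB | hqW)
    · exact infDist_le_dist_of_mem hqB
    · exact hz.trans (infDist_le_dist_of_mem hqW)
  · -- (←): `infDist z B ≤ dist z b ≤ infDist z W`.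
    rintro ⟨b, hbB, hb⟩
    rw [Literature.Probability.LatticeModels.mem_voronoiCell_iff] at hb
    exact (infDist_le_dist_of_mem hbB).trans ((le_infDist hWne).2 fun w hw => hb w (Or.inr hw))

end Summit.CriticalPhenomena.CardyFormulaZ2.Cruxes.VoronoiHubFromSmirnov.MoebiusExactDelaunayDilationWard
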